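import Mathlib
import Summits.CriticalPhenomena.PercolationContinuityZ3.Theorems.PercNearOneGluingNearOneGluingKnLemma3i
import Literature.Probability.Percolation.PercolationProofs
import Literature.Probability.LatticeModels.RandomClusterFKG
import HarnessLib

/-!
# Crux `PercNearOneGluing.NearOneGluing` (stmt-CriticalPhenomena-4574), line `SketchR2I5` — stub `stub_pivotalityDomination`

Helper file for the crux (lead prover-line-stmt-CriticalPhenomena-4574-c3, cycle 3): the
**pivotality domination** lemma of the least-reliable-first (LRF) programme, depth one.
Proves exactly the registered stub signature; lands with `--supports stmt-CriticalPhenomena-4574`.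

## Content

On the finite weighted graph `Fin n` (`μ = prodBernoulli w` on bond configurations
`ω : Set (Sym2 (Fin n))`): if `μ(a₁ ↔ b) ≤ μ(a₂ ↔ b)` then for every vertex `o`, with
`e₁ = s(o, a₁)`,
`μ{ω ∉ a₂↔b, insert e₁ ω ∈ a₂↔b} ≤ μ{ω ∉ a₁↔b, insert e₁ ω ∈ a₁↔b}`.

Proof.  A new open path created by inserting `e₁` must use `e₁`
(`Literature.Probability.LatticeModels.reachable_sup_edge_imp`), so
`{ω ∉ a₂↔b, insert e₁ ω ∈ a₂↔b} ⊆ ({a₂↮b} ∩ {a₂↔o} ∩ {a₁↔b}) ∪ ({a₂↮b} ∩ {a₂↔a₁} ∩ {o↔b})`.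
By Kozma–Nitzan Lemma 3(i) (`knLemma3i`, `d = 0`, `Q = {a₂ ↔ o}`, which is increasing in the open
edge cluster of `a₂`), `μ({a₁↔b} ∩ {a₂↔o}) ≤ μ({a₂↔b} ∩ {a₂↔o})`; removing the common part
`{a₁↔b} ∩ {a₂↔o} ∩ {a₂↔b}` bounds the first piece by `μ({a₂↔b} ∩ {a₂↔o} ∩ {a₁↮b})`.  The second
piece lies in `{a₁↮b} ∩ {o↔b} ∩ {a₂↮b}`.  The two bounding events are disjoint and both lie in
`{a₁↮b} ∩ {o ↔ b} ⊆ {ω ∉ a₁↔b, insert e₁ ω ∈ a₁↔b}`.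
-/

namespace Summit.CriticalPhenomena.PercolationContinuityZ3.Theorems

open MeasureTheory Set Literature.Probability.LatticeModels Literature.Probability.Percolation
open scoped Classical BigOperators

section PivotalityDomination

variable {V : Type*}

/-- Inserting the pair `s(u, v)` into a configuration only adds the adjacency `u ∼ v` to the open
graph: `openGraph (insert s(u,v) ω) ≤ openGraph ω ⊔ edge u v`. [folklore] -/
theorem pivDom_openGraph_insert_le (ω : Set (Sym2 V)) (u v : V) :
    openGraph (insert s(u, v) ω) ≤ openGraph ω ⊔ SimpleGraph.edge u v := by
  intro x y hxy
  rw [openGraph_adj, Set.mem_insert_iff] at hxy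
  rw [SimpleGraph.sup_adj, SimpleGraph.edge_adj, openGraph_adj]
  rcases hxy with ⟨hxy | hxy, hne⟩
  · exact Or.inr ⟨Sym2.eq_iff.1 hxy, hne⟩
  · exact Or.inl ⟨hxy, hne⟩

/-- **A new open path uses the new edge.**  If `x ↔ y` after inserting the pair `s(u, v)`, then
already in `ω` either `x ↔ y`, or `x ↔ u` and `v ↔ y`, or `x ↔ v` and `u ↔ y`. [folklore] -/
theorem pivDom_reachable_insert (ω : Set (Sym2 V)) (u v x y : V)
    (h : (openGraph (insert s(u, v) ω)).Reachable x y) :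
    (openGraph ω).Reachable x y ∨
      ((openGraph ω).Reachable x u ∧ (openGraph ω).Reachable v y) ∨
      ((openGraph ω).Reachable x v ∧ (openGraph ω).Reachable u y) :=
  reachable_sup_edge_imp (openGraph ω) u v (h.mono (pivDom_openGraph_insert_le ω u v))

/-- If `u ≠ v` and `v ↔ y` in `ω`, then `u ↔ y` after inserting the pair `s(u, v)`. [folklore] -/
theorem pivDom_reachable_insert_of (ω : Set (Sym2 V)) {u v y : V} (huv : u ≠ v)
    (h : (openGraph ω).Reachable v y) :
    (openGraph (insert s(u, v) ω)).Reachable u y := by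
  have hadj : (openGraph (insert s(u, v) ω)).Adj u v :=
    (openGraph_adj _ u v).2 ⟨Set.mem_insert _ _, huv⟩
  exact hadj.reachable.trans (h.mono (openGraph_mono (Set.subset_insert _ _)))

/-- The connection event `{s ↔ a}` is increasing in the open edge cluster of `s`
(hypothesis shape of `knLemma3i`). [cite: VandenbergHaggstromKahn2005, §1 p. 3] -/
theorem pivDom_openConn_mono_openEdgeCluster (s a : V) :
    ∀ ω ω' : BondConfig V, ω ∈ (openConn s a : Set (BondConfig V)) →
      openEdgeCluster ω s ⊆ openEdgeCluster ω' s → ω' ∈ (openConn s a : Set (BondConfig V)) := by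
  intro ω ω' hω hsub
  rcases (reachable_iff_exists_mem_openEdgeCluster ω s a).1 hω with h | ⟨e, he, hae⟩
  · exact (reachable_iff_exists_mem_openEdgeCluster ω' s a).2 (Or.inl h)
  · exact (reachable_iff_exists_mem_openEdgeCluster ω' s a).2 (Or.inr ⟨e, hsub he, hae⟩)

end PivotalityDomination

/-- **Pivotality domination** (LRF programme, depth one; from Kozma–Nitzan Lemma 3(i) with `d = 0`,
`Q = {a₂ ↔ o}`): if `μ(a₁ ↔ b) ≤ μ(a₂ ↔ b)` then the pair `e₁ = s(o, a₁)` is at least as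
closed-pivotal for `a₁ ↔ b` as for `a₂ ↔ b`:
`μ{ω ∉ a₂↔b, insert e₁ ω ∈ a₂↔b} ≤ μ{ω ∉ a₁↔b, insert e₁ ω ∈ a₁↔b}`. -/
theorem stub_pivotalityDomination :
    ∀ (n : ℕ) (w : Sym2 (Fin n) → unitInterval) (o a₁ a₂ b : Fin n),
      (prodBernoulli w).real (openConn a₁ b) ≤ (prodBernoulli w).real (openConn a₂ b) →
      (prodBernoulli w).real {ω | ω ∉ openConn a₂ b ∧ insert s(o, a₁) ω ∈ openConn a₂ b} ≤
        (prodBernoulli w).real {ω | ω ∉ openConn a₁ b ∧ insert s(o, a₁) ω ∈ openConn a₁ b} := by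
  intro n w o a₁ a₂ b hle
  -- notation
  set μ := prodBernoulli w with hμ
  set L : Set (BondConfig (Fin n)) :=
    {ω | ω ∉ openConn a₂ b ∧ insert s(o, a₁) ω ∈ openConn a₂ b} with hL
  set R : Set (BondConfig (Fin n)) :=
    {ω | ω ∉ openConn a₁ b ∧ insert s(o, a₁) ω ∈ openConn a₁ b} with hR
  -- the four auxiliary events
  set Q : Set (BondConfig (Fin n)) := openConn a₂ o with hQ
  set E₁ : Set (BondConfig (Fin n)) := (openConn a₁ b ∩ Q) \ openConn a₂ b with hE₁
  set E₂ : Set (BondConfig (Fin n)) := (openConn a₂ b)ᶜ ∩ openConn a₂ a₁ ∩ openConn o b with hE₂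
  set F₁ : Set (BondConfig (Fin n)) := (openConn a₂ b ∩ Q) \ openConn a₁ b with hF₁
  set R₂ : Set (BondConfig (Fin n)) := (openConn a₁ b)ᶜ ∩ openConn o b ∩ (openConn a₂ b)ᶜ with hR₂
  -- (ii) a new open `a₂–b` path uses `e₁`
  have hLsub : L ⊆ E₁ ∪ E₂ := by
    intro ω hω
    obtain ⟨h1, h2⟩ := hω
    rcases pivDom_reachable_insert ω o a₁ a₂ b h2 with h | ⟨hu, hv⟩ | ⟨hu, hv⟩
    · exact absurd h h1
    · exact Or.inl ⟨⟨hv, hu⟩, h1⟩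
    · exact Or.inr ⟨⟨h1, hu⟩, hv⟩
  -- (iii) KN Lemma 3(i) with `d = 0`, `Q = {a₂ ↔ o}`
  have hkn : μ.real (openConn a₁ b ∩ Q) ≤ μ.real (openConn a₂ b ∩ Q) := by
    have h := knLemma3i n w a₁ a₂ b Q 0 (pivDom_openConn_mono_openEdgeCluster a₂ o) le_rfl
      (by simpa using hle)
    simpa using h
  -- (iv) remove the common part
  have hmeas : ∀ s : Set (BondConfig (Fin n)), MeasurableSet s := fun _ => MeasurableSet.of_discrete
  have hE₁le : μ.real E₁ ≤ μ.real F₁ := by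
    have h1 := measureReal_inter_add_sdiff (μ := μ) (s := openConn a₁ b ∩ Q) (hmeas (openConn a₂ b))
    have h2 := measureReal_inter_add_sdiff (μ := μ) (s := openConn a₂ b ∩ Q) (hmeas (openConn a₁ b))
    have hc : (openConn a₁ b ∩ Q) ∩ openConn a₂ b = (openConn a₂ b ∩ Q) ∩ openConn a₁ b := by
      ext ω
      simp only [Set.mem_inter_iff]
      tauto
    rw [hc] at h1
    linarith
  -- the second piece
  have hE₂sub : E₂ ⊆ R₂ := by
    rintro ω ⟨⟨h1, h2⟩, h3⟩
    refine ⟨⟨fun h => h1 (SimpleGraph.Reachable.trans h2 h), h3⟩, h1⟩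
  -- both bounding events lie in `R`
  have hF₁sub : F₁ ⊆ R := by
    rintro ω ⟨⟨h1, h2⟩, h3⟩
    refine ⟨h3, ?_⟩
    rcases eq_or_ne a₁ o with h | h
    · subst h
      exact absurd (SimpleGraph.Reachable.trans (SimpleGraph.Reachable.symm h2) h1) h3
    · have h4 : (openGraph ω).Reachable o b :=
        SimpleGraph.Reachable.trans (SimpleGraph.Reachable.symm h2) h1
      have h5 := pivDom_reachable_insert_of ω h (SimpleGraph.Reachable.refl o)
      -- `a₁ ↔ o` in `insert s(a₁, o) ω = insert s(o, a₁) ω`, then `o ↔ b`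
      rw [Sym2.eq_swap] at h5
      exact h5.trans (h4.mono (openGraph_mono (Set.subset_insert _ _)))
  have hR₂sub : R₂ ⊆ R := by
    rintro ω ⟨⟨h1, h2⟩, -⟩
    refine ⟨h1, ?_⟩
    rcases eq_or_ne a₁ o with h | h
    · subst h
      exact absurd h2 h1
    · have h5 := pivDom_reachable_insert_of ω h (SimpleGraph.Reachable.refl o)
      rw [Sym2.eq_swap] at h5
      exact h5.trans (h2.mono (openGraph_mono (Set.subset_insert _ _)))
  have hdisj : Disjoint F₁ R₂ := by
    rw [Set.disjoint_left]
    rintro ω ⟨⟨h1, -⟩, -⟩ ⟨-, h2⟩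
    exact h2 h1
  -- conclude
  calc μ.real L ≤ μ.real (E₁ ∪ E₂) := measureReal_mono hLsub
    _ ≤ μ.real E₁ + μ.real E₂ := measureReal_union_le E₁ E₂
    _ ≤ μ.real F₁ + μ.real R₂ := add_le_add hE₁le (measureReal_mono hE₂sub)
    _ = μ.real (F₁ ∪ R₂) := (measureReal_union hdisj (hmeas R₂)).symm
    _ ≤ μ.real R := measureReal_mono (Set.union_subset hF₁sub hR₂sub)

end Summit.CriticalPhenomena.PercolationContinuityZ3.Theorems
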